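import Literature.Topology.FourManifolds.SurgeryRegularDomain
import HarnessLib

/-!
# The piece `W = {ĝ ≤ 0}` of a manifold surgered inside a regular domain is the surgery of the
# domain

Topic `Literature/Topology/FourManifolds` (fact seat
`provefact-Literature.Topology.FourManifolds.Matvey-69322e0896`, rung (H4)
`Literature.Topology.FourManifolds.Matveyev1996_partOne_and_fact_of_dualSpheres` of
`CorkDecompositionMiddleLevel.lean`; vocabulary of `SphereFamilySurgery.lean`,
`RegularLevelSplitting.lean`, `SurgeryRegularDomain.lean`).  Matveyev 1996 (arXiv:dg-ga/9505001),
Proof of Theorem, step 3: *"Surgery of `V₃` along collections of embedded spheres `{Sᵢ}` and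
`{Pᵢ}` gives two contractible sub-manifolds `W₁` and `W₂` of `M₁` and `M₂`"*.  In the tree,
`M₁ = X` is obtained from `N` by surgery along the framed family `P` (Milnor 1965, Def. 3.11:
`X = jA(N ∖ cores) ∪ jB(ι × OD^{k+1} × Sˡ)` glued along Milnor's identification), the domain is
`V = {g ≤ 0}`, and `W₁ = {ĝ ≤ 0} ⊆ X` for the descended level function `ĝ` of
`FramedSphereFamily.exists_isRegularLevel_glue` (`ĝ ∘ jA = levelCutoff δ ∘ g`, `ĝ ∘ jB ≡ -δ`).
This file proves the sentence *"`W₁` is the surgery of `V` along `P`"* in the topological form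
consumed by the surgical engine `FramedSphereFamily.isZero_singularHomology_of_surgery_middle`
(Kervaire–Milnor 1963, Lemma 7.1): **`W₁` is covered by open embeddings of `V ∖ cores` and of
`ι × OD^{k+1} × Sˡ` identified exactly along Milnor's relation for the family `P` read in `V`**
(`FramedSphereFamily.exists_restrict_regularSublevel`).  Everything here is proved; no
definitions, no named facts:

* **`Literature.Topology.FourManifolds.FramedSphereFamily.exists_surgeryPresentation_sublevel`**.

## References

* R. Matveyev, *A decomposition of smooth simply-connected h-cobordant 4-manifolds*,
  J. Differential Geom. 44 (1996) 571–582; arXiv:dg-ga/9505001, Proof of Theorem, step 3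
  (arXiv p. 2). [Matveyev1996]
* J. Milnor, *Lectures on the h-cobordism theorem*, Princeton (1965), Def. 3.11 (PDF p. 17).
  [MilnorHCobordism1965]
* M. Kervaire, J. Milnor, *Groups of homotopy spheres I*, Ann. of Math. 77 (1963), Lemma 7.1.
  [KervaireMilnorAnnals1963]
-/

noncomputable section

open scoped Manifold ContDiff Topology
open Set Function Metric Topology

namespace Literature.Topology.FourManifolds

universe u v w

namespace FramedSphereFamily

variable {n k l : ℕ} {N : Type u} [TopologicalSpace N] [T2Space N]
  [ChartedSpace (EuclideanSpace ℝ (Fin (n + 1))) N] [IsManifold (𝓡 (n + 1)) ∞ N]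
  {ι : Type w} [Finite ι]

/-- **The piece `W = {ĝ ≤ 0}` of the surgered manifold is the surgery of `V = {g ≤ 0}`**
(Matveyev 1996, step 3; Milnor 1965, Def. 3.11).  Let `X` be obtained from `N` by surgery along
the framed family `P` — open embeddings `jA : N ∖ cores → X`, `jB : ι × OD^{k+1} × Sˡ → X`
covering `X` and identified exactly along Milnor's relation — let `0` be a regular value of
`g : N → ℝ`, `P^V` the family `P` read in `V = {g ≤ 0}` (`incl ∘ P^Vᵢ = Pᵢ`), and `ĝ : X → ℝ`
with `ĝ ∘ jA = levelCutoff δ ∘ g` (`δ > 0`) and `ĝ ∘ jB ≡ -δ`.  Then `W = {ĝ ≤ 0}` is covered by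
the open embeddings `a ↦ jA a` of `V ∖ cores(P^V)` and `b ↦ jB b` of `ι × OD^{k+1} × Sˡ`,
identified exactly along Milnor's relation for `P^V`.
[cite: Matveyev1996, Proof of Theorem, step 3 (arXiv p. 2)]
[cite: MilnorHCobordism1965, Def. 3.11 (PDF p. 17)] -/
theorem exists_surgeryPresentation_sublevel (P : FramedSphereFamily (𝓡 (n + 1)) N ι k (l + 1))
    {g : N → ℝ} (h0 : IsRegularLevel (𝓡 (n + 1)) g 0)
    (PV : FramedSphereFamily (𝓡∂ (n + 1)) (RegularSublevel h0) ι k (l + 1))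
    (hPV : ∀ i q, RegularSublevel.incl h0 (PV.toFun i q) = P.toFun i q)
    {X : Type v} [TopologicalSpace X] {jA : ↥P.complement → X}
    {jB : ↥(ballTimesSphere ι k l) → X} (hA : IsOpenEmbedding jA) (hB : IsOpenEmbedding jB)
    (hcov : range jA ∪ range jB = univ) (hrel : ∀ a b, jA a = jB b ↔ sphereFamilySurgeryRel P a b)
    {δ : ℝ} (hδ : 0 < δ) {ĝ : X → ℝ} (hgA : ∀ a, ĝ (jA a) = levelCutoff δ (g a))
    (hgB : ∀ b, ĝ (jB b) = -δ) :
    ∃ (hcA : ∀ a : ↥(PV.coresᶜ), RegularSublevel.incl h0 a.1 ∈ P.complement)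
      (jAW : ↥(PV.coresᶜ) → ↥(ĝ ⁻¹' Iic 0)) (jBW : ↥(ballTimesSphere ι k l) → ↥(ĝ ⁻¹' Iic 0)),
      IsOpenEmbedding jAW ∧ IsOpenEmbedding jBW ∧ range jAW ∪ range jBW = univ ∧
      (∀ a b, jAW a = jBW b ↔ sphereFamilySurgeryRel PV a b) ∧
      (∀ a, (jAW a : X) = jA ⟨RegularSublevel.incl h0 a.1, hcA a⟩) ∧ ∀ b, (jBW b : X) = jB b := by
  -- the cores of `P^V` are the cores of `P` read in `V`
  have hsph : ∀ i v, RegularSublevel.incl h0 (PV.sphere i v) = P.sphere i v := fun i v => by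
    rw [sphere_apply, sphere_apply, hPV]
  have hcores : ∀ a : RegularSublevel h0, a ∈ PV.cores ↔ RegularSublevel.incl h0 a ∈ P.cores := by
    intro a
    rw [mem_cores_iff, mem_cores_iff]
    constructor
    · rintro ⟨i, v, rfl⟩
      exact ⟨i, v, (hsph i v).symm⟩
    · rintro ⟨i, v, hv⟩
      exact ⟨i, v, RegularSublevel.injective_incl h0 (by rw [hsph, hv])⟩
  have hcA : ∀ a : ↥(PV.coresᶜ), RegularSublevel.incl h0 a.1 ∈ P.complement := fun a => by
    rw [mem_complement_iff, ← hcores]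
    exact a.2
  -- the two maps into `W = {ĝ ≤ 0}`
  have hleA : ∀ a : ↥(PV.coresᶜ), ĝ (jA ⟨RegularSublevel.incl h0 a.1, hcA a⟩) ≤ 0 := fun a => by
    rw [hgA, levelCutoff_nonpos_iff hδ]
    exact RegularSublevel.apply_incl_le h0 a.1
  have hleB : ∀ b : ↥(ballTimesSphere ι k l), ĝ (jB b) ≤ 0 := fun b => by
    rw [hgB]; linarith
  let jAW : ↥(PV.coresᶜ) → ↥(ĝ ⁻¹' Iic 0) := fun a =>
    ⟨jA ⟨RegularSublevel.incl h0 a.1, hcA a⟩, hleA a⟩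
  let jBW : ↥(ballTimesSphere ι k l) → ↥(ĝ ⁻¹' Iic 0) := fun b => ⟨jB b, hleB b⟩
  -- the map `iA : V ∖ cores(P^V) → N ∖ cores(P)` is an embedding onto `{g ≤ 0} ∖ cores`
  let iA : ↥(PV.coresᶜ) → ↥P.complement := fun a => ⟨RegularSublevel.incl h0 a.1, hcA a⟩
  have hiA : IsEmbedding iA :=
    ((RegularSublevel.isEmbedding_incl h0).comp IsEmbedding.subtypeVal).codRestrict _ _
  have hlift : ∀ a' : ↥P.complement, g a' ≤ 0 → ∃ a : ↥(PV.coresᶜ), iA a = a' := by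
    intro a' ha'
    have hnot : RegularSublevel.mk h0 (a' : N) ha' ∉ PV.cores := by
      rw [hcores]
      exact a'.2
    exact ⟨⟨RegularSublevel.mk h0 (a' : N) ha', hnot⟩, rfl⟩
  -- `jAW` is an open embedding with range `W ∩ jA(N ∖ cores)`
  have hrA : range jAW = Subtype.val ⁻¹' range jA := by
    ext w
    constructor
    · rintro ⟨a, rfl⟩
      exact ⟨iA a, rfl⟩
    · rintro ⟨a', hw⟩
      have hle : g a' ≤ 0 := by
        have h1 : ĝ w.1 ≤ 0 := w.2
        rw [← hw, hgA, levelCutoff_nonpos_iff hδ] at h1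
        exact h1
      obtain ⟨a, rfl⟩ := hlift a' hle
      exact ⟨a, Subtype.ext hw⟩
  have hAW : IsOpenEmbedding jAW := by
    have hemb : IsEmbedding (Subtype.val ∘ jAW) := hA.isEmbedding.comp hiA
    refine ⟨IsEmbedding.of_comp ((hA.continuous.comp hiA.continuous).subtype_mk _)
      continuous_subtype_val hemb, ?_⟩
    rw [hrA]
    exact hA.isOpen_range.preimage continuous_subtype_val
  -- `jBW` is an open embedding with range `W ∩ jB(new piece)`
  have hrB : range jBW = Subtype.val ⁻¹' range jB := by
    ext w
    constructor
    · rintro ⟨b, rfl⟩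
      exact ⟨b, rfl⟩
    · rintro ⟨b, hw⟩
      exact ⟨b, Subtype.ext hw⟩
  have hBW : IsOpenEmbedding jBW := by
    have hemb : IsEmbedding (Subtype.val ∘ jBW) := hB.isEmbedding
    refine ⟨IsEmbedding.of_comp (hB.continuous.subtype_mk _) continuous_subtype_val hemb, ?_⟩
    rw [hrB]
    exact hB.isOpen_range.preimage continuous_subtype_val
  refine ⟨hcA, jAW, jBW, hAW, hBW, ?_, fun a b => ?_, fun a => rfl, fun b => rfl⟩
  · -- the two pieces cover `W`
    rw [hrA, hrB, ← preimage_union, hcov, preimage_univ]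
  · -- Milnor's relation for `P` read in `V` is Milnor's relation for `P^V`
    rw [show jAW a = jBW b ↔ jA (iA a) = jB b from
      ⟨fun h => congrArg Subtype.val h, fun h => Subtype.ext h⟩, hrel]
    simp only [sphereFamilySurgeryRel]
    constructor
    · rintro ⟨v, θ, hθ, hy, ha⟩
      refine ⟨v, θ, hθ, hy, RegularSublevel.injective_incl h0 ?_⟩
      rw [hPV]
      exact ha
    · rintro ⟨v, θ, hθ, hy, ha⟩
      refine ⟨v, θ, hθ, hy, ?_⟩
      show RegularSublevel.incl h0 a.1 = _
      rw [ha, hPV]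

end FramedSphereFamily

end Literature.Topology.FourManifolds

end
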